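import Summits.Ventures.PercRepro0.Bridge
import Summits.Ventures.PercRepro0.ContinuityCoupling
import Summits.Ventures.PercRepro0.ZeroOneKolmogorov

/-!
# R_MID-1 · EQUIVALENT-FORMS on the cell's definitions (seat p3)

Kernel-checked twin of proofs/RMID-p6-v1.md §2 (block M; a REDUCTION of the residual, not progress
on its truth): for every `d`, `Defs.RMID1_Equivalents d` holds unconditionally —

* (a) ⟺ (b): `T d ↔ P_{p_c}(0 ↔ ∂Λ_n) → 0` — from L2 (`tendsto_P_toBoundary`, p5's
  ContinuityCoupling) through `Bridge.T_iff_tendsto_toBoundary`;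
* (a) ⟺ (c): `T d ↔ P_{p_c}(∃ infinite open cluster) = 0` — from L5 (`L5_ZeroOne_holds`, p5's
  ZeroOneKolmogorov: `P_p(E) ∈ {0,1}` and `P_p(E) = 1 ↔ θ_d(p) > 0`).

No definitions, no hypotheses; nothing here decides `T d` for any `3 ≤ d ≤ 10`.
-/

namespace Summit.Ventures.PercRepro0.RMidOne

open MeasureTheory ProbabilityTheory unitInterval Defs Filter Topology

/-- R_MID-1 (a) ⟺ (b), unconditional: `T d ↔ P_{p_c(d)}(0 ↔ ∂Λ_n) → 0` (L2). -/
theorem T_iff_tendsto_toBoundary' (d : ℕ) :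
    T d ↔ Tendsto (fun n : ℕ => (P d (clamp (pc d)) (toBoundary d n)).toReal) atTop (𝓝 0) :=
  T_iff_tendsto_toBoundary (tendsto_P_toBoundary (clamp (pc d)))

/-- At any `p`: `θ_d(p) = 0 ↔ P_p(∃ infinite open cluster) = 0` (L5). -/
theorem thetaI_eq_zero_iff_P_existsInfCluster (d : ℕ) (p : I) :
    thetaI d p = 0 ↔ P d p (existsInfCluster d) = 0 := by
  obtain ⟨h01, hiff⟩ := L5_ZeroOne_holds d p
  constructor
  · intro hθ
    rcases h01 with h0 | h1
    · exact h0
    · exact absurd (hiff.1 h1) (by rw [hθ]; exact lt_irrefl 0)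
  · intro h0
    by_contra hne
    have hpos : 0 < thetaI d p := lt_of_le_of_ne (thetaI_nonneg d p) (Ne.symm hne)
    have h1 := hiff.2 hpos
    rw [h0] at h1
    exact zero_ne_one h1

/-- R_MID-1 (a) ⟺ (c), unconditional: `T d ↔ P_{p_c(d)}(∃ infinite open cluster) = 0`. -/
theorem T_iff_P_existsInfCluster_eq_zero (d : ℕ) :
    T d ↔ P d (clamp (pc d)) (existsInfCluster d) = 0 :=
  thetaI_eq_zero_iff_P_existsInfCluster d (clamp (pc d))

/-- **R_MID-1 · EQUIVALENT-FORMS holds** for every `d` (RMID-p6-v1 §2, both equivalences). -/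
theorem RMID1_Equivalents_holds (d : ℕ) : RMID1_Equivalents d :=
  ⟨T_iff_tendsto_toBoundary' d, T_iff_P_existsInfCluster_eq_zero d⟩

end Summit.Ventures.PercRepro0.RMidOne
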